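import Mathlib
import Summits.NavierStokesRegularity.NavierStokesRegularity.Theorems.SubOnsagerCeilingKPDarkShellBarrier
import Summits.NavierStokesRegularity.NavierStokesRegularity.Theorems.SubcriticalEnvelopeForwardSourceTailEnvelopeKPPermClass
import HarnessLib

/-!
# TRUNCATED KP permutation networks (a broken feed cycle) satisfy the primary graded barrier at EVERY scale
# ratio — non-vacuity of the dark-shell corner inside `E₂(2)` (helper file for crux stmt-NavierStokesRegularity-27057
# `SubOnsagerCeiling.ForwardTailCeilingKP`, `--supports`; sequel of `SubOnsagerCeilingKPDarkShellBarrier`)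

`SubOnsagerCeilingKPDarkShellBarrier` proved the conclusion of the LEAD skeleton's `PrimaryGradedAt R ε₀ α`
(Cruxes/ForwardTailCeilingKP/Lines/kp_shell_barrier.lean; registered stubs `stub_primaryGradedLargeRatio` /
`stub_primaryGradedSmallRatio`) for every RANKED KP network proper (`kpProper_ranked_primaryGraded`).  This file
exhibits the ranked class INSIDE the tables of record: LEAD SE's permutation networks `kpPermTable σ c`
(p638990; feed `a → σ a` with weight `c a`, Katz–Pavlović back-reactions, no in-shell part) with a weight
vector `c ≥ 0` that VANISHES SOMEWHERE ON EVERY CYCLE of `σ` — a truncated permutation network, whose feed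
graph is a disjoint union of directed paths:

* `kpPerm_truncated_primaryGraded` — if a rank `r < K` increases along every live feed
  (`c a ≠ 0 → r a < r (σ a)`), the conclusion of `PrimaryGradedAt R ε₀ (kpPermTable σ c)` holds for every
  `ε₀ > 0` (grading `lev ≡ 0`, `θ = 1`, `D = ((1+ε₀)²)^K`);
* `kpPerm_feedForwardChain_primaryGraded` — the FEED-FORWARD CHAIN `0 → 1 → 2 → 3` into a dead end
  (`σ = finRotate 4`, `c = (1,1,1,0)`, `r = id`, `K = 4`): the three premises of `PrimaryGradedAt` are
  DISCHARGED (`kpPermTable_inTableClass` with `R = 2`, `kpPermTable_orthant`, `kpPermTable_diagonal`) and the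
  graded barrier holds outright at every `ε₀ > 0`.  This table lies in the class of both registered stubs and
  in NO landed rung (RUNG 6 `rung_kpPerm` needs `c` constant on `σ`-orbits and `ε₀ ≥ 9/20`).

HONEST FRAMING: statements about Tao-type MODEL lattice ODEs (route SubOnsagerCeiling, rung TL-M2Break); a
degenerate (non-recurrent) corner of the registered stubs; nothing here bears on Navier–Stokes regularity and no
stub, crux or summit is proved. [cite: Tao2016AveragedNS, §4 (4.2)–(4.3), (4.13)]
-/

noncomputable section

-- the sub-problem namespace `NavierStokesRegularity.NavierStokesRegularity` is the tree's layout (D-0017)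
set_option linter.dupNamespace false

namespace Summit.NavierStokesRegularity.NavierStokesRegularity.Theorems

open Set Finset
open Literature.Analysis.FluidPDE.TaoCascade

/-- **TRUNCATED PERMUTATION NETWORKS SATISFY THE PRIMARY GRADED BARRIER AT EVERY SCALE RATIO.**  For a
permutation network `kpPermTable σ c` and a rank `r : Fin 4 → ℕ`, `r < K`, with `r a < r (σ a)` whenever the
feed `a → σ a` is live (`c a ≠ 0`; so `c` vanishes somewhere on every cycle of `σ`), the conclusion of the LEAD
skeleton's `PrimaryGradedAt R ε₀ (kpPermTable σ c)` holds VERBATIM for every `ε₀ > 0` (grading `lev ≡ 0`,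
`L = 0`, `θ = 1`, `D = ((1+ε₀)²)^K`), by `kpProper_ranked_primaryGraded` (no in-shell couplings:
`kpPermTable_inshell`). MODEL lattice statement; no stub, crux or summit is proved.
[cite: Tao2016AveragedNS, §4 (4.2)–(4.3), (4.13)] -/
theorem kpPerm_truncated_primaryGraded (σ : Equiv.Perm (Fin 4)) (c : Fin 4 → ℝ) (r : Fin 4 → ℕ) (K : ℕ)
    (hrK : ∀ i, r i < K) (hr : ∀ a, c a ≠ 0 → r a < r (σ a)) (R ε₀ : ℝ) (hε : 0 < ε₀) :
    Literature.Analysis.FluidPDE.TaoCascade.InTableClass R (kpPermTable σ c) →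
    (∀ (Y : Fin 4 → ℤ → ℝ → ℝ) (τ : ℝ), (∀ (j : Fin 4) (k : ℤ), 1 ≤ k → 0 ≤ Y j k τ) → ∀ δ : ℝ, 0 < δ →
      ∀ (i : Fin 4) (n : ℤ), 1 ≤ n → Y i n τ = 0 →
        0 ≤ Literature.Analysis.FluidPDE.TaoCascade.quadTerm δ (kpPermTable σ c) Y i n τ) →
    (∀ a b i : Fin 4, a ≠ b → kpPermTable σ c a b i (0, 0, 1) = 0) →
    ∃ (lev : Fin 4 → ℕ) (L : ℕ), (∀ a, lev a ≤ L) ∧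
      (∀ a, lev a ≠ 0 → (∃ e, kpPermTable σ c a a e (0, 0, 1) ≠ 0) →
        (∀ j, kpPermTable σ c j j a (0, 0, 1) ≠ 0 →
          lev j < lev a ∧ (lev j = 0 ∨ ∃ e', kpPermTable σ c j j e' (0, 0, 1) ≠ 0)) ∧
        (∀ i₁ i₂, i₁ ≠ a → i₂ ≠ a → kpPermTable σ c i₁ i₂ a (0, 0, 0) ≠ 0 →
          (lev i₁ < lev a ∧ (lev i₁ = 0 ∨ ∃ e', kpPermTable σ c i₁ i₁ e' (0, 0, 1) ≠ 0)) ∧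
          (lev i₂ < lev a ∧ (lev i₂ = 0 ∨ ∃ e', kpPermTable σ c i₂ i₂ e' (0, 0, 1) ≠ 0))) ∧
        (∃ e, kpPermTable σ c a a e (0, 0, 1) ≠ 0 ∧
          (∀ j, kpPermTable σ c e e j (0, 0, 1) ≠ 0 →
            lev j < lev a ∧ (lev j = 0 ∨ ∃ e', kpPermTable σ c j j e' (0, 0, 1) ≠ 0)) ∧
          (∀ j, j ≠ e → kpPermTable σ c e e j (0, 0, 0) ≠ 0 →
            lev j < lev a ∧ (lev j = 0 ∨ ∃ e', kpPermTable σ c j j e' (0, 0, 1) ≠ 0)))) ∧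
      ∃ θ : ℝ, 1 / 2 < θ ∧ θ ≤ 1 ∧ ∃ D : ℝ, 0 ≤ D ∧
        ∀ ν : ℝ, 0 < ν → ∀ (X₀ : Fin 4 → ℝ) (s : ℝ), 0 < s → ∀ X : Fin 4 → ℤ → ℝ → ℝ,
        (∀ (i : Fin 4) (k : ℤ), X i k 0 = if k = 0 then X₀ i else 0) →
        (∀ (i : Fin 4) (k : ℤ), k < 0 → ∀ t : ℝ, X i k t = 0) →
        (∃ M : ℝ, ∀ (t : ℝ) (i : Fin 4) (k : ℤ), (1 + (1 + ε₀) ^ ((10 : ℝ) * k)) * |X i k t| ≤ M) →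
        (∀ (i : Fin 4) (k : ℤ), Continuous (X i k)) →
        (∀ (i : Fin 4) (k : ℤ), ∀ t ∈ Set.Icc (0 : ℝ) s, HasDerivWithinAt (X i k)
          (Literature.Analysis.FluidPDE.TaoCascade.quadTerm ε₀ (kpPermTable σ c) X i k t -
            ν * (1 + ε₀) ^ ((2 : ℝ) * k) * X i k t) (Set.Icc (0 : ℝ) s) t) →
        (∀ t ∈ Set.Icc (0 : ℝ) s, ∀ (i : Fin 4) (k : ℤ), 1 ≤ k → 0 ≤ X i k t) →
        ∀ t ∈ Set.Icc (0 : ℝ) s, ∀ i, lev i = 0 → ∀ k : ℕ,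
          (1 + ε₀) ^ (2 * θ * (k : ℝ)) * ((1 / 2 : ℝ) * X i (k : ℤ) t ^ 2) ≤
            D * (∑ j : Fin 4, (1 / 2 : ℝ) * X₀ j ^ 2) := by
  refine kpProper_ranked_primaryGraded R ε₀ hε (kpPermTable σ c) r K hrK ?_ ?_
  · intro a i h
    rw [kpPermTable_feed] at h
    by_cases hi : a = a ∧ i = σ a
    · rw [if_pos hi] at h
      rw [hi.2]
      exact hr a h
    · rw [if_neg hi] at h
      exact absurd rfl h
  · intro a b i _ _ h
    exact absurd (kpPermTable_inshell σ c a b i) h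

/-- **THE FEED-FORWARD CHAIN `0 → 1 → 2 → 3` INTO A DEAD END satisfies the primary graded barrier outright, at
every scale ratio.**  The table `kpPermTable (finRotate 4) c`, `c = (1,1,1,0)` (Katz–Pavlović feeds
`x_{0,k}² → x_{1,k+1}'`, `x_{1,k}² → x_{2,k+1}'`, `x_{2,k}² → x_{3,k+1}'` with unit weights, the closing feed
`3 → 0` switched off) is a KP network proper of `E₂(2)`: `InTableClass 2`, orthant, diagonal feeds — the three
premises of `PrimaryGradedAt` are discharged — and the graded barrier (grading `lev ≡ 0`, `θ = 1`,
`D = ((1+ε₀)²)^4`) holds for every `ε₀ > 0`: the energy climbs exactly three shells along the modes `0,1,2,3`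
and stops.  In the class of both registered stubs, in no landed rung. MODEL lattice statement; no stub, crux
or summit is proved. [cite: Tao2016AveragedNS, §4 (4.2)–(4.3), (4.13)] -/
theorem kpPerm_feedForwardChain_primaryGraded (ε₀ : ℝ) (hε : 0 < ε₀) :
    let α := kpPermTable (finRotate 4) (fun a : Fin 4 => if a = 3 then (0 : ℝ) else 1)
    Literature.Analysis.FluidPDE.TaoCascade.InTableClass 2 α ∧
    (∀ (Y : Fin 4 → ℤ → ℝ → ℝ) (τ : ℝ), (∀ (j : Fin 4) (k : ℤ), 1 ≤ k → 0 ≤ Y j k τ) → ∀ δ : ℝ, 0 < δ →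
      ∀ (i : Fin 4) (n : ℤ), 1 ≤ n → Y i n τ = 0 →
        0 ≤ Literature.Analysis.FluidPDE.TaoCascade.quadTerm δ α Y i n τ) ∧
    (∀ a b i : Fin 4, a ≠ b → α a b i (0, 0, 1) = 0) ∧
    ∃ (lev : Fin 4 → ℕ) (L : ℕ), (∀ a, lev a ≤ L) ∧
      (∀ a, lev a ≠ 0 → (∃ e, α a a e (0, 0, 1) ≠ 0) →
        (∀ j, α j j a (0, 0, 1) ≠ 0 → lev j < lev a ∧ (lev j = 0 ∨ ∃ e', α j j e' (0, 0, 1) ≠ 0)) ∧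
        (∀ i₁ i₂, i₁ ≠ a → i₂ ≠ a → α i₁ i₂ a (0, 0, 0) ≠ 0 →
          (lev i₁ < lev a ∧ (lev i₁ = 0 ∨ ∃ e', α i₁ i₁ e' (0, 0, 1) ≠ 0)) ∧
          (lev i₂ < lev a ∧ (lev i₂ = 0 ∨ ∃ e', α i₂ i₂ e' (0, 0, 1) ≠ 0))) ∧
        (∃ e, α a a e (0, 0, 1) ≠ 0 ∧
          (∀ j, α e e j (0, 0, 1) ≠ 0 → lev j < lev a ∧ (lev j = 0 ∨ ∃ e', α j j e' (0, 0, 1) ≠ 0)) ∧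
          (∀ j, j ≠ e → α e e j (0, 0, 0) ≠ 0 →
            lev j < lev a ∧ (lev j = 0 ∨ ∃ e', α j j e' (0, 0, 1) ≠ 0)))) ∧
      ∃ θ : ℝ, 1 / 2 < θ ∧ θ ≤ 1 ∧ ∃ D : ℝ, 0 ≤ D ∧
        ∀ ν : ℝ, 0 < ν → ∀ (X₀ : Fin 4 → ℝ) (s : ℝ), 0 < s → ∀ X : Fin 4 → ℤ → ℝ → ℝ,
        (∀ (i : Fin 4) (k : ℤ), X i k 0 = if k = 0 then X₀ i else 0) →
        (∀ (i : Fin 4) (k : ℤ), k < 0 → ∀ t : ℝ, X i k t = 0) →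
        (∃ M : ℝ, ∀ (t : ℝ) (i : Fin 4) (k : ℤ), (1 + (1 + ε₀) ^ ((10 : ℝ) * k)) * |X i k t| ≤ M) →
        (∀ (i : Fin 4) (k : ℤ), Continuous (X i k)) →
        (∀ (i : Fin 4) (k : ℤ), ∀ t ∈ Set.Icc (0 : ℝ) s, HasDerivWithinAt (X i k)
          (Literature.Analysis.FluidPDE.TaoCascade.quadTerm ε₀ α X i k t -
            ν * (1 + ε₀) ^ ((2 : ℝ) * k) * X i k t) (Set.Icc (0 : ℝ) s) t) →
        (∀ t ∈ Set.Icc (0 : ℝ) s, ∀ (i : Fin 4) (k : ℤ), 1 ≤ k → 0 ≤ X i k t) →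
        ∀ t ∈ Set.Icc (0 : ℝ) s, ∀ i, lev i = 0 → ∀ k : ℕ,
          (1 + ε₀) ^ (2 * θ * (k : ℝ)) * ((1 / 2 : ℝ) * X i (k : ℤ) t ^ 2) ≤
            D * (∑ j : Fin 4, (1 / 2 : ℝ) * X₀ j ^ 2) := by
  intro α
  set c : Fin 4 → ℝ := fun a : Fin 4 => if a = 3 then (0 : ℝ) else 1 with hc
  have hc0 : ∀ a, 0 ≤ c a := fun a => by
    simp only [hc]; split_ifs <;> norm_num
  have hcR : ∀ a, c a = 0 ∨ (2 / (2 : ℝ) ≤ |c a| ∧ |c a| ≤ 1) := fun a => by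
    simp only [hc]; split_ifs <;> norm_num
  have hT : Literature.Analysis.FluidPDE.TaoCascade.InTableClass 2 α :=
    kpPermTable_inTableClass (σ := finRotate 4) two_pos hcR
  have hO := kpPermTable_orthant (σ := finRotate 4) hc0
  have hD := kpPermTable_diagonal (finRotate 4) c
  refine ⟨hT, hO, hD, ?_⟩
  have hr : ∀ a, c a ≠ 0 → (a : ℕ) < ((finRotate 4 a : Fin 4) : ℕ) := by
    intro a ha
    simp only [hc] at ha
    fin_cases a <;> simp_all
  exact kpPerm_truncated_primaryGraded (finRotate 4) c (fun a => (a : ℕ)) 4 (fun i => i.isLt) hr 2 ε₀ hε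
    hT hO hD

/-! ## The ONE-WAY Katz–Pavlović pair (appended 2026-08-31) -/

/-- **THE ONE-WAY PAIR `kpTwoCycleTable c₀ 0` (feed `x_{0,k}² → x_{1,k+1}'`, return feed switched off) satisfies the
primary graded barrier at EVERY `ε₀ > 0`**: by `kpPermTable_swap_eq_twoCycle` it is the truncated permutation network
`kpPermTable (swap 0 1) (c₀, 0, 0, 0)`, ranked by `r = (0, 1, 0, 0)`, `K = 2` (the energy climbs one shell into the dead
end `1`).  RUNG 8 (`rung_kpTwoCycle`) covers the uniform pair `c₀ = c₁ > 0` only; the ASYMMETRIC live pair `c₀ ≠ c₁`,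
both `> 0`, stays open (alternating-rate strands). MODEL lattice statement; no stub, crux or summit is proved.
[cite: Tao2016AveragedNS, §4 (4.2)–(4.3), (4.13)] -/
theorem kpTwoCycle_oneWay_primaryGraded (c₀ R ε₀ : ℝ) (hε : 0 < ε₀) :
    Literature.Analysis.FluidPDE.TaoCascade.InTableClass R (kpTwoCycleTable c₀ 0) →
    (∀ (Y : Fin 4 → ℤ → ℝ → ℝ) (τ : ℝ), (∀ (j : Fin 4) (k : ℤ), 1 ≤ k → 0 ≤ Y j k τ) → ∀ δ : ℝ, 0 < δ →
      ∀ (i : Fin 4) (n : ℤ), 1 ≤ n → Y i n τ = 0 →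
        0 ≤ Literature.Analysis.FluidPDE.TaoCascade.quadTerm δ (kpTwoCycleTable c₀ 0) Y i n τ) →
    (∀ a b i : Fin 4, a ≠ b → (kpTwoCycleTable c₀ 0) a b i (0, 0, 1) = 0) →
    ∃ (lev : Fin 4 → ℕ) (L : ℕ), (∀ a, lev a ≤ L) ∧
      (∀ a, lev a ≠ 0 → (∃ e, (kpTwoCycleTable c₀ 0) a a e (0, 0, 1) ≠ 0) →
        (∀ j, (kpTwoCycleTable c₀ 0) j j a (0, 0, 1) ≠ 0 →
          lev j < lev a ∧ (lev j = 0 ∨ ∃ e', (kpTwoCycleTable c₀ 0) j j e' (0, 0, 1) ≠ 0)) ∧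
        (∀ i₁ i₂, i₁ ≠ a → i₂ ≠ a → (kpTwoCycleTable c₀ 0) i₁ i₂ a (0, 0, 0) ≠ 0 →
          (lev i₁ < lev a ∧ (lev i₁ = 0 ∨ ∃ e', (kpTwoCycleTable c₀ 0) i₁ i₁ e' (0, 0, 1) ≠ 0)) ∧
          (lev i₂ < lev a ∧ (lev i₂ = 0 ∨ ∃ e', (kpTwoCycleTable c₀ 0) i₂ i₂ e' (0, 0, 1) ≠ 0))) ∧
        (∃ e, (kpTwoCycleTable c₀ 0) a a e (0, 0, 1) ≠ 0 ∧
          (∀ j, (kpTwoCycleTable c₀ 0) e e j (0, 0, 1) ≠ 0 →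
            lev j < lev a ∧ (lev j = 0 ∨ ∃ e', (kpTwoCycleTable c₀ 0) j j e' (0, 0, 1) ≠ 0)) ∧
          (∀ j, j ≠ e → (kpTwoCycleTable c₀ 0) e e j (0, 0, 0) ≠ 0 →
            lev j < lev a ∧ (lev j = 0 ∨ ∃ e', (kpTwoCycleTable c₀ 0) j j e' (0, 0, 1) ≠ 0)))) ∧
      ∃ θ : ℝ, 1 / 2 < θ ∧ θ ≤ 1 ∧ ∃ D : ℝ, 0 ≤ D ∧
        ∀ ν : ℝ, 0 < ν → ∀ (X₀ : Fin 4 → ℝ) (s : ℝ), 0 < s → ∀ X : Fin 4 → ℤ → ℝ → ℝ,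
        (∀ (i : Fin 4) (k : ℤ), X i k 0 = if k = 0 then X₀ i else 0) →
        (∀ (i : Fin 4) (k : ℤ), k < 0 → ∀ t : ℝ, X i k t = 0) →
        (∃ M : ℝ, ∀ (t : ℝ) (i : Fin 4) (k : ℤ), (1 + (1 + ε₀) ^ ((10 : ℝ) * k)) * |X i k t| ≤ M) →
        (∀ (i : Fin 4) (k : ℤ), Continuous (X i k)) →
        (∀ (i : Fin 4) (k : ℤ), ∀ t ∈ Set.Icc (0 : ℝ) s, HasDerivWithinAt (X i k)
          (Literature.Analysis.FluidPDE.TaoCascade.quadTerm ε₀ (kpTwoCycleTable c₀ 0) X i k t -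
            ν * (1 + ε₀) ^ ((2 : ℝ) * k) * X i k t) (Set.Icc (0 : ℝ) s) t) →
        (∀ t ∈ Set.Icc (0 : ℝ) s, ∀ (i : Fin 4) (k : ℤ), 1 ≤ k → 0 ≤ X i k t) →
        ∀ t ∈ Set.Icc (0 : ℝ) s, ∀ i, lev i = 0 → ∀ k : ℕ,
          (1 + ε₀) ^ (2 * θ * (k : ℝ)) * ((1 / 2 : ℝ) * X i (k : ℤ) t ^ 2) ≤
            D * (∑ j : Fin 4, (1 / 2 : ℝ) * X₀ j ^ 2) := by
  rw [← kpPermTable_swap_eq_twoCycle]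
  refine kpPerm_truncated_primaryGraded (Equiv.swap 0 1) _ (fun a => if a = 1 then 1 else 0) 2
    (fun i => by split_ifs <;> norm_num) (fun a ha => ?_) R ε₀ hε
  have ha0 : a = 0 := by
    by_contra h
    by_cases h1 : a = 1 <;> simp [h, h1] at ha
  subst ha0
  simp

/-- **THE ONE-WAY PAIR `kpTwoCycleTable 0 c₁`** (feed `x_{1,k}² → x_{0,k+1}'` only): the same with `r = (1, 0, 0, 0)`.
MODEL lattice statement; no stub, crux or summit is proved. [cite: Tao2016AveragedNS, §4 (4.2)–(4.3), (4.13)] -/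
theorem kpTwoCycle_oneWay'_primaryGraded (c₁ R ε₀ : ℝ) (hε : 0 < ε₀) :
    Literature.Analysis.FluidPDE.TaoCascade.InTableClass R (kpTwoCycleTable 0 c₁) →
    (∀ (Y : Fin 4 → ℤ → ℝ → ℝ) (τ : ℝ), (∀ (j : Fin 4) (k : ℤ), 1 ≤ k → 0 ≤ Y j k τ) → ∀ δ : ℝ, 0 < δ →
      ∀ (i : Fin 4) (n : ℤ), 1 ≤ n → Y i n τ = 0 →
        0 ≤ Literature.Analysis.FluidPDE.TaoCascade.quadTerm δ (kpTwoCycleTable 0 c₁) Y i n τ) →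
    (∀ a b i : Fin 4, a ≠ b → (kpTwoCycleTable 0 c₁) a b i (0, 0, 1) = 0) →
    ∃ (lev : Fin 4 → ℕ) (L : ℕ), (∀ a, lev a ≤ L) ∧
      (∀ a, lev a ≠ 0 → (∃ e, (kpTwoCycleTable 0 c₁) a a e (0, 0, 1) ≠ 0) →
        (∀ j, (kpTwoCycleTable 0 c₁) j j a (0, 0, 1) ≠ 0 →
          lev j < lev a ∧ (lev j = 0 ∨ ∃ e', (kpTwoCycleTable 0 c₁) j j e' (0, 0, 1) ≠ 0)) ∧
        (∀ i₁ i₂, i₁ ≠ a → i₂ ≠ a → (kpTwoCycleTable 0 c₁) i₁ i₂ a (0, 0, 0) ≠ 0 →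
          (lev i₁ < lev a ∧ (lev i₁ = 0 ∨ ∃ e', (kpTwoCycleTable 0 c₁) i₁ i₁ e' (0, 0, 1) ≠ 0)) ∧
          (lev i₂ < lev a ∧ (lev i₂ = 0 ∨ ∃ e', (kpTwoCycleTable 0 c₁) i₂ i₂ e' (0, 0, 1) ≠ 0))) ∧
        (∃ e, (kpTwoCycleTable 0 c₁) a a e (0, 0, 1) ≠ 0 ∧
          (∀ j, (kpTwoCycleTable 0 c₁) e e j (0, 0, 1) ≠ 0 →
            lev j < lev a ∧ (lev j = 0 ∨ ∃ e', (kpTwoCycleTable 0 c₁) j j e' (0, 0, 1) ≠ 0)) ∧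
          (∀ j, j ≠ e → (kpTwoCycleTable 0 c₁) e e j (0, 0, 0) ≠ 0 →
            lev j < lev a ∧ (lev j = 0 ∨ ∃ e', (kpTwoCycleTable 0 c₁) j j e' (0, 0, 1) ≠ 0)))) ∧
      ∃ θ : ℝ, 1 / 2 < θ ∧ θ ≤ 1 ∧ ∃ D : ℝ, 0 ≤ D ∧
        ∀ ν : ℝ, 0 < ν → ∀ (X₀ : Fin 4 → ℝ) (s : ℝ), 0 < s → ∀ X : Fin 4 → ℤ → ℝ → ℝ,
        (∀ (i : Fin 4) (k : ℤ), X i k 0 = if k = 0 then X₀ i else 0) →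
        (∀ (i : Fin 4) (k : ℤ), k < 0 → ∀ t : ℝ, X i k t = 0) →
        (∃ M : ℝ, ∀ (t : ℝ) (i : Fin 4) (k : ℤ), (1 + (1 + ε₀) ^ ((10 : ℝ) * k)) * |X i k t| ≤ M) →
        (∀ (i : Fin 4) (k : ℤ), Continuous (X i k)) →
        (∀ (i : Fin 4) (k : ℤ), ∀ t ∈ Set.Icc (0 : ℝ) s, HasDerivWithinAt (X i k)
          (Literature.Analysis.FluidPDE.TaoCascade.quadTerm ε₀ (kpTwoCycleTable 0 c₁) X i k t -
            ν * (1 + ε₀) ^ ((2 : ℝ) * k) * X i k t) (Set.Icc (0 : ℝ) s) t) →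
        (∀ t ∈ Set.Icc (0 : ℝ) s, ∀ (i : Fin 4) (k : ℤ), 1 ≤ k → 0 ≤ X i k t) →
        ∀ t ∈ Set.Icc (0 : ℝ) s, ∀ i, lev i = 0 → ∀ k : ℕ,
          (1 + ε₀) ^ (2 * θ * (k : ℝ)) * ((1 / 2 : ℝ) * X i (k : ℤ) t ^ 2) ≤
            D * (∑ j : Fin 4, (1 / 2 : ℝ) * X₀ j ^ 2) := by
  rw [← kpPermTable_swap_eq_twoCycle]
  refine kpPerm_truncated_primaryGraded (Equiv.swap 0 1) _ (fun a => if a = 0 then 1 else 0) 2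
    (fun i => by split_ifs <;> norm_num) (fun a ha => ?_) R ε₀ hε
  have ha1 : a = 1 := by
    by_contra h
    by_cases h0 : a = 0 <;> simp [h, h0] at ha
  subst ha1
  simp

end Summit.NavierStokesRegularity.NavierStokesRegularity.Theorems

end
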